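import Literature.Geometry.Kaehler.ComplexTorusLefschetzLieAlgebraRatFunctoriality
import Literature.Geometry.Kaehler.ComplexTorusHodgeLieAlgebraRatForm
import Literature.Geometry.Kaehler.ComplexTorusHodgeLieAlgebraIsogeny
import Literature.Geometry.Kaehler.ComplexTorusHodgeLieAlgebraProductsPowers
import HarnessLib

/-!
# Functoriality of the Hodge Lie algebra over `ℚ`: `𝒜(X₂) = V(f) · 𝒜(X₁) · V(f)⁻¹` for an isogeny (`𝒜(X₁) ≃ₗ⁅ℚ⁆ 𝒜(X₂)`,
# «`Hg` depends only on the isogeny class»), `𝒜(Xᴺ) = 1_N ⊗ 𝒜(X)` («`Hg(Xⁿ) = Hg(X)` acting diagonally») and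
# `𝒜(X₁ × X₂) ⊆ 𝒜(X₁) ⊕ 𝒜(X₂)` (GGK III.B (i)), for complex tori — no polarisation anywhere

Layer `Literature/Geometry/Kaehler`, namespace `Literature.Geometry.Kaehler.ComplexTorus`; lane `lit-hodgefound`
(Track 2 foundations library), Layer A4; prover seat `lit-hodgefound-p36` (generation 18, self-proposed row g18-#10: the
`𝒜`-twin of g18-#3 = Q2950 `ComplexTorusLefschetzLieAlgebraRatFunctoriality`).  THEOREMS ONLY — no definition, no named
fact, net debt 0: every statement is DESCENDED BY NAME from p17's real statements (`mem_hodgeGroupLie_iff_of_homRat`,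
`mul_mul_mem_hodgeGroupLie_of_mem_homRat`, `hodgeGroupLie_comm_iff_of_homRat` of `ComplexTorusHodgeLieAlgebraIsogeny`;
`coe_hodgeGroupLie_pow`, `diagPow_mem_hodgeGroupLie_pow_iff` of `ComplexTorusHodgeLieAlgebraHodgeClassesOfPowers`;
`toBlocks₁₁_mem_hodgeGroupLie`, `toBlocks₂₂_mem_hodgeGroupLie`, `eq_fromBlocks_of_mem_hodgeGroupLie_prod` of
`ComplexTorusHodgeLieAlgebraProductsPowers`) along Q2990's `A ∈ 𝒜 ↔ A ⊗ 1 ∈ 𝔥𝔤_ℝ` (`mem_hodgeGroupLieRat_iff`), with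
Q2950's `conjLieEquivRat` (`Z ↦ P Z Q` on `M(ℚ)`), the tree's `diagPow_eq_one_kronecker`, `one_kronecker_map`,
`submatrix_one_kronecker`, `IsIsogeny.exists_homRat_inverse`, `IsIsogeny.map_intCast_mem_homRat`.

## Sources, verbatim

* [MoonenZarhin1999LowDim] B. Moonen, Yu. G. Zarhin, *Hodge classes on abelian varieties of low dimension*, Math. Ann. 315
  (1999), (0.2)(4): the Hodge group of isogenous abelian varieties are identified through the isogeny; §1: «For `n ≥ 1` we
  can identify `Hg(Xⁿ)` with `Hg(X)`, acting diagonally on `V^{⊕n}`».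
* [GreenGriffithsKerr2012] M. Green, P. Griffiths, M. Kerr, *Mumford–Tate Groups and Domains*, §I.B (I.B.3)–(I.B.4)
  (functoriality of `M_φ` under direct sums and isomorphisms) and §III.B (i) (p. 72): «`M_{φ₁+φ₂} ⊂ M_{φ₁} × M_{φ₂}` […]
  the inclusions (i), (ii) are in general not isomorphisms»; §II.C, Lemma after (II.C.1) («`𝒜 ⊂ 𝔤` … defined over `ℚ`»).
* [Hall2015] B. C. Hall, *Lie Groups, Lie Algebras, and Representations*, 2nd ed., Thm. 3.20 (1) and Thm. 3.28 (the Lie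
  algebra of `P G P⁻¹` is `P 𝔤 P⁻¹`; the Lie algebra of a product / of the image of a homomorphism).
* [Milne1999LefschetzClasses] J. S. Milne, *Lefschetz classes on abelian varieties*, §1 (p. 643): «An isogeny `α: A → B`
  defines an isomorphism `γ ↦ V(α) ∘ γ ∘ V(α)⁻¹` […] the diagonal action of `C(A)` on `rV(A)`».

## What is here (`𝒜 = hodgeGroupLieRat`; `V(f) = P`, `V(f)⁻¹ = Q` mutually inverse rational matrices, `P ∈ Hom_ℚ(X₁, X₂)`)

* §1 ISOGENIES: `conj_mem_hodgeGroupLieRat_of_mem_homRat` (`A ∈ 𝒜(X₁) ⟹ P A Q ∈ 𝒜(X₂)`),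
  **`mem_hodgeGroupLieRat_iff_of_homRat`** (`B ∈ 𝒜(X₂) ⟺ Q B P ∈ 𝒜(X₁)`), **`hodgeGroupLieRat_eq_map_conj`**
  (`𝒜(X₂) = P · 𝒜(X₁) · Q` as the image under Q2950's `conjLieEquivRat`), `nonempty_hodgeGroupLieRat_lieEquiv_of_homRat`,
  `IsIsogeny.hodgeGroupLieRat_eq_map_conj`, **`IsIsogeny.nonempty_hodgeGroupLieRat_lieEquiv`**,
  **`IsIsogenous.nonempty_hodgeGroupLieRat_lieEquiv`** (`𝒜(X₁) ≃ₗ⁅ℚ⁆ 𝒜(X₂)`), `IsIsogenous.finrank_hodgeGroupLieRat_eq`,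
  `IsIsogenous.hodgeGroupLieRat_comm_iff`, `IsIsogenous.isLieAbelian_hodgeGroupLieRat_iff`.
* §2 POWERS (`N ≥ 1`): `one_kronecker_mem_hodgeGroupLieRat_pow`, **`mem_hodgeGroupLieRat_pow_iff`** (`𝒜(Xᴺ) = 1_N ⊗ 𝒜(X)`),
  `coe_hodgeGroupLieRat_pow`, **`finrank_hodgeGroupLieRat_pow`** (`dim_ℚ 𝒜(Xᴺ) = dim_ℚ 𝒜(X)`).
* §3 PRODUCTS: `toBlocks₁₂_eq_zero_of_mem_hodgeGroupLieRat_prod`, `toBlocks₂₁_eq_zero_of_mem_hodgeGroupLieRat_prod`,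
  **`toBlocks₁₁_mem_hodgeGroupLieRat`**, **`toBlocks₂₂_mem_hodgeGroupLieRat`**, `eq_fromBlocks_of_mem_hodgeGroupLieRat_prod`,
  **`exists_eq_fromBlocks_of_mem_hodgeGroupLieRat_prod`** (`𝒜(X₁ × X₂) ⊆ 𝒜(X₁) ⊕ 𝒜(X₂)`), `finrank_hodgeGroupLieRat_prod_le`.

NOT here: surjectivity of the projections `𝒜(X₁ × X₂) → 𝒜(X_i)` (needs Lie algebras of images of algebraic-group morphisms);
`𝒜(X₁ × X₂) = 𝒜(X₁) ⊕ 𝒜(X₂)` criteria; the `ℚ`-Lie-algebra isomorphism `𝒜(X) ≃ₗ⁅ℚ⁆ 𝒜(Xᴺ)` as a bundled equivalence.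
-/

noncomputable section

-- Mathlib idiom (`Mathlib/Algebra/Lie/OfAssociative.lean`, as in the imported files): the commutator bracket on
-- `M_ι(ℚ)` / `M_ι(ℝ)` is the non-instance `LieRing.ofAssociativeRing`, enabled file-locally.
attribute [local instance 100] LieRing.ofAssociativeRing

open scoped Matrix Kronecker
open Set Function Module Matrix

namespace Literature.Geometry.Kaehler

namespace ComplexTorus

/-! ## §1 Isogenies: `𝒜(X₂) = V(f) · 𝒜(X₁) · V(f)⁻¹` over `ℚ` -/

section Isogeny

variable {ι₁ ι₂ : Type*} [Fintype ι₁] [Fintype ι₂] [DecidableEq ι₁] [DecidableEq ι₂]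
  {E₁ E₂ : Type*} [NormedAddCommGroup E₁] [NormedSpace ℂ E₁] [NormedAddCommGroup E₂] [NormedSpace ℂ E₂]
  {Φ₁ : (ι₁ → ℝ) ≃L[ℝ] E₁} {Φ₂ : (ι₂ → ℝ) ≃L[ℝ] E₂}

omit [DecidableEq ι₁] [DecidableEq ι₂] in
/-- `(P A Q) ⊗ 1 = (P ⊗ 1)(A ⊗ 1)(Q ⊗ 1)` (rectangular). [folklore] -/
private theorem map_ratCast_mul_mul {κ₁ κ₂ κ₃ κ₄ : Type*} [Fintype κ₂] [Fintype κ₃] (P : Matrix κ₁ κ₂ ℚ)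
    (A : Matrix κ₂ κ₃ ℚ) (Q : Matrix κ₃ κ₄ ℚ) :
    (P * A * Q).map ((↑) : ℚ → ℝ) = P.map ((↑) : ℚ → ℝ) * A.map ((↑) : ℚ → ℝ) * Q.map ((↑) : ℚ → ℝ) := by
  rw [show ((↑) : ℚ → ℝ) = (Rat.castHom ℝ : ℚ → ℝ) from rfl, Matrix.map_mul, Matrix.map_mul]

/-- A Lie subalgebra of `𝔤𝔩_ι(R)` (commutator bracket) is abelian iff its elements commute as matrices. [folklore] -/
private theorem isLieAbelian_iff_forall_mul_comm₁₀ {ι : Type*} [Fintype ι] [DecidableEq ι] {R : Type*} [CommRing R]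
    (K : LieSubalgebra R (Matrix ι ι R)) : IsLieAbelian K ↔ ∀ X ∈ K, ∀ Y ∈ K, X * Y = Y * X := by
  constructor
  · intro h X hX Y hY
    have h0 := congrArg Subtype.val (h.trivial ⟨X, hX⟩ ⟨Y, hY⟩)
    rw [LieSubalgebra.coe_bracket, Ring.lie_def, ZeroMemClass.coe_zero] at h0
    exact sub_eq_zero.1 h0
  · intro h
    exact ⟨fun X Y ↦ Subtype.ext (by
      rw [LieSubalgebra.coe_bracket, Ring.lie_def, ZeroMemClass.coe_zero, h X.1 X.2 Y.1 Y.2, sub_self])⟩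

/-- **`A ∈ 𝒜(X₁) ⟹ V(f) A V(f)⁻¹ ∈ 𝒜(X₂)`** for mutually inverse `P ∈ Hom_ℚ(X₁, X₂)`, `Q` (`QP = 1`, `PQ = 1`) —
p17's `mul_mul_mem_hodgeGroupLie_of_mem_homRat` on `A ⊗ 1`. [cite: MoonenZarhin1999LowDim, (0.2)(4) and (2.1)]
[cite: Hall2015, Theorem 3.20 (1) and Theorem 3.28] [cite: GreenGriffithsKerr2012, §I.B (I.B.4)] -/
theorem conj_mem_hodgeGroupLieRat_of_mem_homRat {P : Matrix ι₂ ι₁ ℚ} {Q : Matrix ι₁ ι₂ ℚ} (hP : P ∈ homRat Φ₁ Φ₂)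
    (hQP : Q * P = 1) (hPQ : P * Q = 1) {A : Matrix ι₁ ι₁ ℚ} (hA : A ∈ hodgeGroupLieRat Φ₁) :
    P * A * Q ∈ hodgeGroupLieRat Φ₂ := by
  rw [mem_hodgeGroupLieRat_iff, map_ratCast_mul_mul]
  exact mul_mul_mem_hodgeGroupLie_of_mem_homRat hP hQP hPQ hA

/-- **`B ∈ 𝒜(X₂) ⟺ V(f)⁻¹ B V(f) ∈ 𝒜(X₁)`** (mutually inverse rational `P ∈ Hom_ℚ(X₁, X₂)`, `Q`).
[cite: MoonenZarhin1999LowDim, (0.2)(4) and (2.1)] [cite: Hall2015, Theorem 3.28] -/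
theorem mem_hodgeGroupLieRat_iff_of_homRat {P : Matrix ι₂ ι₁ ℚ} {Q : Matrix ι₁ ι₂ ℚ} (hP : P ∈ homRat Φ₁ Φ₂)
    (hQP : Q * P = 1) (hPQ : P * Q = 1) {B : Matrix ι₂ ι₂ ℚ} :
    B ∈ hodgeGroupLieRat Φ₂ ↔ Q * B * P ∈ hodgeGroupLieRat Φ₁ := by
  rw [mem_hodgeGroupLieRat_iff, mem_hodgeGroupLieRat_iff, mem_hodgeGroupLie_iff_of_homRat hP hQP hPQ, map_ratCast_mul_mul]

/-- **ISOGENY TRANSPORT OF `𝒜`: `𝒜(X₂) = V(f) · 𝒜(X₁) · V(f)⁻¹`** as the image of `𝒜(X₁)` under Q2950's `ℚ`-Lie-algebra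
equivalence `conjLieEquivRat P Q : Z ↦ P Z Q` of `M(ℚ)`. [cite: MoonenZarhin1999LowDim, (0.2)(4) and (2.1)] [cite: Hall2015, Theorem 3.28]
[cite: Milne1999LefschetzClasses, §1 (p. 643: "`γ ↦ V(α) ∘ γ ∘ V(α)⁻¹`")] -/
theorem hodgeGroupLieRat_eq_map_conj {P : Matrix ι₂ ι₁ ℚ} {Q : Matrix ι₁ ι₂ ℚ} (hP : P ∈ homRat Φ₁ Φ₂)
    (hQP : Q * P = 1) (hPQ : P * Q = 1) :
    hodgeGroupLieRat Φ₂ = (hodgeGroupLieRat Φ₁).map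
      ((conjLieEquivRat P Q hQP hPQ : Matrix ι₁ ι₁ ℚ ≃ₗ⁅ℚ⁆ Matrix ι₂ ι₂ ℚ) : Matrix ι₁ ι₁ ℚ →ₗ⁅ℚ⁆ Matrix ι₂ ι₂ ℚ) := by
  ext B
  rw [LieSubalgebra.mem_map]
  constructor
  · intro hB
    refine ⟨Q * B * P, (mem_hodgeGroupLieRat_iff_of_homRat hP hQP hPQ).1 hB, ?_⟩
    rw [conjLieEquivRat_toLieHom_apply]
    calc P * (Q * B * P) * Q = P * Q * B * (P * Q) := by simp only [Matrix.mul_assoc]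
      _ = B := by rw [hPQ, Matrix.one_mul, Matrix.mul_one]
  · rintro ⟨A, hA, rfl⟩
    rw [conjLieEquivRat_toLieHom_apply]
    exact conj_mem_hodgeGroupLieRat_of_mem_homRat hP hQP hPQ hA

/-- `𝒜(X₁) ≃ₗ⁅ℚ⁆ 𝒜(X₂)` along mutually inverse rational `P ∈ Hom_ℚ(X₁, X₂)`, `Q`. [cite: MoonenZarhin1999LowDim, (0.2)(4)]
[cite: Hall2015, Theorem 3.28] -/
theorem nonempty_hodgeGroupLieRat_lieEquiv_of_homRat {P : Matrix ι₂ ι₁ ℚ} {Q : Matrix ι₁ ι₂ ℚ}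
    (hP : P ∈ homRat Φ₁ Φ₂) (hQP : Q * P = 1) (hPQ : P * Q = 1) :
    Nonempty (hodgeGroupLieRat Φ₁ ≃ₗ⁅ℚ⁆ hodgeGroupLieRat Φ₂) :=
  ⟨(conjLieEquivRat P Q hQP hPQ).ofSubalgebras _ _ (hodgeGroupLieRat_eq_map_conj hP hQP hPQ).symm⟩

/-- **`𝒜(X₂) = V(f) · 𝒜(X₁) · V(f)⁻¹` for an isogeny `f : X₁ → X₂`** (integer matrix `A`, rational inverse `Q = V(f)⁻¹`).
[cite: MoonenZarhin1999LowDim, (0.2)(4) and (2.1)] [cite: Hall2015, Theorem 3.28] -/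
theorem IsIsogeny.hodgeGroupLieRat_eq_map_conj {A : Matrix ι₂ ι₁ ℤ} (hA : IsIsogeny Φ₁ Φ₂ A) {Q : Matrix ι₁ ι₂ ℚ}
    (hQP : Q * A.map (Int.cast : ℤ → ℚ) = 1) (hPQ : A.map (Int.cast : ℤ → ℚ) * Q = 1) :
    hodgeGroupLieRat Φ₂ = (hodgeGroupLieRat Φ₁).map
      ((conjLieEquivRat (A.map (Int.cast : ℤ → ℚ)) Q hQP hPQ : Matrix ι₁ ι₁ ℚ ≃ₗ⁅ℚ⁆ Matrix ι₂ ι₂ ℚ) :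
        Matrix ι₁ ι₁ ℚ →ₗ⁅ℚ⁆ Matrix ι₂ ι₂ ℚ) :=
  ComplexTorus.hodgeGroupLieRat_eq_map_conj hA.map_intCast_mem_homRat hQP hPQ

/-- **`𝒜(X₁) ≃ₗ⁅ℚ⁆ 𝒜(X₂)` for an isogeny `X₁ → X₂`** (no polarisation needed).
[cite: MoonenZarhin1999LowDim, (0.2)(4)] [cite: Hall2015, Theorem 3.28] -/
theorem IsIsogeny.nonempty_hodgeGroupLieRat_lieEquiv {A : Matrix ι₂ ι₁ ℤ} (hA : IsIsogeny Φ₁ Φ₂ A) :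
    Nonempty (hodgeGroupLieRat Φ₁ ≃ₗ⁅ℚ⁆ hodgeGroupLieRat Φ₂) := by
  obtain ⟨Q, -, hQP, hPQ⟩ := hA.exists_homRat_inverse
  exact nonempty_hodgeGroupLieRat_lieEquiv_of_homRat hA.map_intCast_mem_homRat hQP hPQ

/-- **«THE HODGE GROUP DEPENDS ONLY ON THE ISOGENY CLASS», at the `ℚ`-Lie algebra: isogenous complex tori have isomorphic
`𝒜` over `ℚ`.** [cite: MoonenZarhin1999LowDim, (0.2)(4) and (2.1)] [cite: GreenGriffithsKerr2012, §I.B (I.B.4)] -/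
theorem IsIsogenous.nonempty_hodgeGroupLieRat_lieEquiv (h : IsIsogenous Φ₁ Φ₂) :
    Nonempty (hodgeGroupLieRat Φ₁ ≃ₗ⁅ℚ⁆ hodgeGroupLieRat Φ₂) := by
  obtain ⟨A, hA⟩ := h
  exact hA.nonempty_hodgeGroupLieRat_lieEquiv

/-- `dim_ℚ 𝒜(X₁) = dim_ℚ 𝒜(X₂)` for isogenous complex tori. [cite: MoonenZarhin1999LowDim, (0.2)(4)] -/
theorem IsIsogenous.finrank_hodgeGroupLieRat_eq (h : IsIsogenous Φ₁ Φ₂) :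
    finrank ℚ (hodgeGroupLieRat Φ₁) = finrank ℚ (hodgeGroupLieRat Φ₂) := by
  obtain ⟨e⟩ := h.nonempty_hodgeGroupLieRat_lieEquiv
  exact e.toLinearEquiv.finrank_eq

/-- `𝒜(X₁)` is commutative iff `𝒜(X₂)` is, for isogenous complex tori (p17's `IsIsogenous.hodgeGroupLie_comm_iff` read
over `ℚ` through Q2990's `hodgeGroupLieRat_comm_iff_hodgeGroupLie_comm`). [cite: MoonenZarhin1999LowDim, (0.2)(4)] -/
theorem IsIsogenous.hodgeGroupLieRat_comm_iff (h : IsIsogenous Φ₁ Φ₂) :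
    (∀ A ∈ hodgeGroupLieRat Φ₁, ∀ B ∈ hodgeGroupLieRat Φ₁, A * B = B * A) ↔
      ∀ A ∈ hodgeGroupLieRat Φ₂, ∀ B ∈ hodgeGroupLieRat Φ₂, A * B = B * A := by
  rw [hodgeGroupLieRat_comm_iff_hodgeGroupLie_comm, hodgeGroupLieRat_comm_iff_hodgeGroupLie_comm, h.hodgeGroupLie_comm_iff]

/-- `𝒜(X₁)` is an abelian Lie algebra iff `𝒜(X₂)` is, for isogenous complex tori (CM type is an isogeny invariant).
[cite: MoonenZarhin1999LowDim, (0.2)(4)] -/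
theorem IsIsogenous.isLieAbelian_hodgeGroupLieRat_iff (h : IsIsogenous Φ₁ Φ₂) :
    IsLieAbelian (hodgeGroupLieRat Φ₁) ↔ IsLieAbelian (hodgeGroupLieRat Φ₂) := by
  rw [isLieAbelian_iff_forall_mul_comm₁₀, isLieAbelian_iff_forall_mul_comm₁₀, h.hodgeGroupLieRat_comm_iff]

end Isogeny

/-! ## §2 Powers: `𝒜(Xᴺ) = 1_N ⊗ 𝒜(X)` -/

section Pow

variable {ι : Type*} [Fintype ι] [DecidableEq ι] {E : Type*} [NormedAddCommGroup E] [NormedSpace ℂ E]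
  (Φ : (ι → ℝ) ≃L[ℝ] E) (N : ℕ)

omit [Fintype ι] [DecidableEq ι] in
/-- `(1_N ⊗ₖ A) ⊗ 1 = 1_N ⊗ₖ (A ⊗ 1)` for `ℚ → ℝ`. [folklore] -/
private theorem one_kronecker_map_ratCast₁₀ (A : Matrix ι ι ℚ) :
    ((1 : Matrix (Fin N) (Fin N) ℚ) ⊗ₖ A).map ((↑) : ℚ → ℝ) = (1 : Matrix (Fin N) (Fin N) ℝ) ⊗ₖ A.map ((↑) : ℚ → ℝ) := by
  rw [show ((↑) : ℚ → ℝ) = (Rat.castHom ℝ : ℚ → ℝ) from rfl, one_kronecker_map]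

omit [Fintype ι] [DecidableEq ι] in
/-- `A ↦ A ⊗ 1 : M(ℚ) → M(ℝ)` is injective. [folklore] -/
private theorem map_ratCast_injective₁₀ {m : Type*} : Function.Injective fun A : Matrix m m ℚ ↦ A.map ((↑) : ℚ → ℝ) :=
  fun _ _ h ↦ Matrix.map_injective Rat.cast_injective h

/-- **`1_N ⊗ A ∈ 𝒜(Xᴺ)` for `A ∈ 𝒜(X)`** (`N ≥ 1`; the diagonal `Δ_N (A ⊗ 1) ∈ 𝔥𝔤_ℝ(Xᴺ)`).
[cite: MoonenZarhin1999LowDim, §1 ("we can identify `Hg(Xⁿ)` with `Hg(X)`, acting diagonally")] [cite: GreenGriffithsKerr2012, §I.B (I.B.3)] -/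
theorem one_kronecker_mem_hodgeGroupLieRat_pow (hN : 0 < N) {A : Matrix ι ι ℚ} (hA : A ∈ hodgeGroupLieRat Φ) :
    (1 : Matrix (Fin N) (Fin N) ℚ) ⊗ₖ A ∈ hodgeGroupLieRat (powPeriod Φ N) := by
  rw [mem_hodgeGroupLieRat_iff, one_kronecker_map_ratCast₁₀, ← diagPow_eq_one_kronecker]
  exact (diagPow_mem_hodgeGroupLie_pow_iff hN).2 hA

/-- **`𝒜(Xᴺ) = 1_N ⊗ 𝒜(X)`** (`N ≥ 1`): every element of `𝒜(Xᴺ)` is `1_N ⊗ A` with `A ∈ 𝒜(X)` — «`Hg(Xⁿ) = Hg(X)` acting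
diagonally», at the `ℚ`-Lie algebra (p17's `coe_hodgeGroupLie_pow`; the block `A` of a rational `1_N ⊗ A` is rational).
[cite: MoonenZarhin1999LowDim, §1] [cite: GreenGriffithsKerr2012, §I.B (I.B.3)] -/
theorem mem_hodgeGroupLieRat_pow_iff (hN : 0 < N) {B : Matrix (Fin N × ι) (Fin N × ι) ℚ} :
    B ∈ hodgeGroupLieRat (powPeriod Φ N) ↔ ∃ A ∈ hodgeGroupLieRat Φ, B = (1 : Matrix (Fin N) (Fin N) ℚ) ⊗ₖ A := by
  constructor
  · intro hB
    have hB' : B.map ((↑) : ℚ → ℝ) ∈ (hodgeGroupLie (powPeriod Φ N) : Set (Matrix (Fin N × ι) (Fin N × ι) ℝ)) := hB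
    rw [coe_hodgeGroupLie_pow Φ hN] at hB'
    obtain ⟨X, hX, hXB⟩ := hB'
    rw [diagPow_eq_one_kronecker] at hXB
    set k₀ : Fin N := ⟨0, hN⟩
    set A := B.submatrix (Prod.mk k₀) (Prod.mk k₀) with hA
    have hXA : X = A.map ((↑) : ℚ → ℝ) := by
      rw [hA, ← Matrix.submatrix_map, ← hXB, submatrix_one_kronecker]
    refine ⟨A, ?_, map_ratCast_injective₁₀ ?_⟩
    · rw [mem_hodgeGroupLieRat_iff, ← hXA]
      exact hX
    · change B.map ((↑) : ℚ → ℝ) = ((1 : Matrix (Fin N) (Fin N) ℚ) ⊗ₖ A).map ((↑) : ℚ → ℝ)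
      rw [one_kronecker_map_ratCast₁₀, ← hXA, hXB]
  · rintro ⟨A, hA, rfl⟩
    exact one_kronecker_mem_hodgeGroupLieRat_pow Φ N hN hA

/-- `𝒜(Xᴺ) = 1_N ⊗ 𝒜(X)` as subsets of `M(ℚ)`. [cite: MoonenZarhin1999LowDim, §1] -/
theorem coe_hodgeGroupLieRat_pow (hN : 0 < N) :
    (hodgeGroupLieRat (powPeriod Φ N) : Set (Matrix (Fin N × ι) (Fin N × ι) ℚ)) =
      (fun A : Matrix ι ι ℚ ↦ (1 : Matrix (Fin N) (Fin N) ℚ) ⊗ₖ A) '' (hodgeGroupLieRat Φ : Set (Matrix ι ι ℚ)) := by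
  ext B
  rw [SetLike.mem_coe, mem_hodgeGroupLieRat_pow_iff Φ N hN, Set.mem_image]
  exact ⟨fun ⟨A, hA, hBA⟩ ↦ ⟨A, hA, hBA.symm⟩, fun ⟨A, hA, hAB⟩ ↦ ⟨A, hA, hAB.symm⟩⟩

/-- **`dim_ℚ 𝒜(Xᴺ) = dim_ℚ 𝒜(X)`** (`N ≥ 1`): `A ↦ 1_N ⊗ A` is an injective `ℚ`-linear map with image `𝒜(Xᴺ)`.
[cite: MoonenZarhin1999LowDim, §1] [cite: GreenGriffithsKerr2012, §I.B (I.B.3)] -/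
theorem finrank_hodgeGroupLieRat_pow (hN : 0 < N) :
    finrank ℚ (hodgeGroupLieRat (powPeriod Φ N)) = finrank ℚ (hodgeGroupLieRat Φ) := by
  -- the diagonal embedding `Δ_N : A ↦ 1_N ⊗ A` as a `ℚ`-linear map
  let Δ : Matrix ι ι ℚ →ₗ[ℚ] Matrix (Fin N × ι) (Fin N × ι) ℚ :=
    { toFun := fun A ↦ (1 : Matrix (Fin N) (Fin N) ℚ) ⊗ₖ A
      map_add' := fun A B ↦ Matrix.kronecker_add _ _ _
      map_smul' := fun c A ↦ by
        rw [RingHom.id_apply, Matrix.kronecker_smul] }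
  have hΔ : Function.Injective Δ := by
    intro A B h
    have h' := congrArg (fun M : Matrix (Fin N × ι) (Fin N × ι) ℚ ↦ M.submatrix (Prod.mk (⟨0, hN⟩ : Fin N))
      (Prod.mk (⟨0, hN⟩ : Fin N))) h
    simpa only [Δ, LinearMap.coe_mk, AddHom.coe_mk, submatrix_one_kronecker] using h'
  have hmap : (hodgeGroupLieRat (powPeriod Φ N)).toSubmodule = (hodgeGroupLieRat Φ).toSubmodule.map Δ := by
    refine SetLike.coe_injective ?_
    rw [Submodule.map_coe, LieSubalgebra.coe_toSubmodule, LieSubalgebra.coe_toSubmodule, coe_hodgeGroupLieRat_pow Φ N hN]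
    rfl
  change finrank ℚ (hodgeGroupLieRat (powPeriod Φ N)).toSubmodule = finrank ℚ (hodgeGroupLieRat Φ).toSubmodule
  rw [hmap]
  exact (Submodule.equivMapOfInjective _ hΔ _).finrank_eq.symm

end Pow

/-! ## §3 Products: `𝒜(X₁ × X₂) ⊆ 𝒜(X₁) ⊕ 𝒜(X₂)` (GGK III.B (i) over `ℚ`) -/

section Prod

variable {ι₁ ι₂ : Type*} [Fintype ι₁] [Fintype ι₂] [DecidableEq ι₁] [DecidableEq ι₂]
  {E₁ E₂ : Type*} [NormedAddCommGroup E₁] [NormedSpace ℂ E₁] [NormedAddCommGroup E₂] [NormedSpace ℂ E₂]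
  (Φ₁ : (ι₁ → ℝ) ≃L[ℝ] E₁) (Φ₂ : (ι₂ → ℝ) ≃L[ℝ] E₂)

omit [Fintype ι₁] [Fintype ι₂] [DecidableEq ι₁] [DecidableEq ι₂] in
/-- Blocks commute with `· ⊗ 1`. [folklore] -/
private theorem toBlocks_map_ratCast (C : Matrix (ι₁ ⊕ ι₂) (ι₁ ⊕ ι₂) ℚ) :
    (C.map ((↑) : ℚ → ℝ)).toBlocks₁₁ = C.toBlocks₁₁.map ((↑) : ℚ → ℝ) ∧
      (C.map ((↑) : ℚ → ℝ)).toBlocks₁₂ = C.toBlocks₁₂.map ((↑) : ℚ → ℝ) ∧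
      (C.map ((↑) : ℚ → ℝ)).toBlocks₂₁ = C.toBlocks₂₁.map ((↑) : ℚ → ℝ) ∧
      (C.map ((↑) : ℚ → ℝ)).toBlocks₂₂ = C.toBlocks₂₂.map ((↑) : ℚ → ℝ) :=
  ⟨rfl, rfl, rfl, rfl⟩

omit [Fintype ι₁] [Fintype ι₂] [DecidableEq ι₁] [DecidableEq ι₂] in
/-- A rational matrix vanishes iff its realification does. [folklore] -/
private theorem map_ratCast_eq_zero_iff {κ₁ κ₂ : Type*} {M : Matrix κ₁ κ₂ ℚ} : M.map ((↑) : ℚ → ℝ) = 0 ↔ M = 0 := by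
  constructor
  · intro h
    ext i j
    have hij := congrFun (congrFun h i) j
    rw [Matrix.map_apply, Matrix.zero_apply, Rat.cast_eq_zero] at hij
    exact hij
  · rintro rfl
    exact Matrix.map_zero _ Rat.cast_zero

/-- **`C ∈ 𝒜(X₁ × X₂)` has vanishing block `C₁₂`.** [cite: GreenGriffithsKerr2012, §III.B (i) (p. 72: "`M_{φ₁+φ₂} ⊂ M_{φ₁} × M_{φ₂}`")] -/
theorem toBlocks₁₂_eq_zero_of_mem_hodgeGroupLieRat_prod {C : Matrix (ι₁ ⊕ ι₂) (ι₁ ⊕ ι₂) ℚ}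
    (hC : C ∈ hodgeGroupLieRat (prodPeriod Φ₁ Φ₂)) : C.toBlocks₁₂ = 0 := by
  rw [← map_ratCast_eq_zero_iff, ← (toBlocks_map_ratCast C).2.1]
  exact toBlocks₁₂_eq_zero_of_mem_hodgeGroupLie_prod Φ₁ Φ₂ hC

/-- **`C ∈ 𝒜(X₁ × X₂)` has vanishing block `C₂₁`.** [cite: GreenGriffithsKerr2012, §III.B (i) (p. 72)] -/
theorem toBlocks₂₁_eq_zero_of_mem_hodgeGroupLieRat_prod {C : Matrix (ι₁ ⊕ ι₂) (ι₁ ⊕ ι₂) ℚ}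
    (hC : C ∈ hodgeGroupLieRat (prodPeriod Φ₁ Φ₂)) : C.toBlocks₂₁ = 0 := by
  rw [← map_ratCast_eq_zero_iff, ← (toBlocks_map_ratCast C).2.2.1]
  exact toBlocks₂₁_eq_zero_of_mem_hodgeGroupLie_prod Φ₁ Φ₂ hC

/-- **The block `C₁₁` of `C ∈ 𝒜(X₁ × X₂)` lies in `𝒜(X₁)`.** [cite: GreenGriffithsKerr2012, §III.B (i) (p. 72)] [cite: Hall2015, Theorem 3.28] -/
theorem toBlocks₁₁_mem_hodgeGroupLieRat {C : Matrix (ι₁ ⊕ ι₂) (ι₁ ⊕ ι₂) ℚ}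
    (hC : C ∈ hodgeGroupLieRat (prodPeriod Φ₁ Φ₂)) : C.toBlocks₁₁ ∈ hodgeGroupLieRat Φ₁ := by
  rw [mem_hodgeGroupLieRat_iff, ← (toBlocks_map_ratCast C).1]
  exact toBlocks₁₁_mem_hodgeGroupLie Φ₁ Φ₂ hC

/-- **The block `C₂₂` of `C ∈ 𝒜(X₁ × X₂)` lies in `𝒜(X₂)`.** [cite: GreenGriffithsKerr2012, §III.B (i) (p. 72)] [cite: Hall2015, Theorem 3.28] -/
theorem toBlocks₂₂_mem_hodgeGroupLieRat {C : Matrix (ι₁ ⊕ ι₂) (ι₁ ⊕ ι₂) ℚ}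
    (hC : C ∈ hodgeGroupLieRat (prodPeriod Φ₁ Φ₂)) : C.toBlocks₂₂ ∈ hodgeGroupLieRat Φ₂ := by
  rw [mem_hodgeGroupLieRat_iff, ← (toBlocks_map_ratCast C).2.2.2]
  exact toBlocks₂₂_mem_hodgeGroupLie Φ₁ Φ₂ hC

/-- `C ∈ 𝒜(X₁ × X₂)` is the block-diagonal matrix of its diagonal blocks. [cite: GreenGriffithsKerr2012, §III.B (i) (p. 72)] -/
theorem eq_fromBlocks_of_mem_hodgeGroupLieRat_prod {C : Matrix (ι₁ ⊕ ι₂) (ι₁ ⊕ ι₂) ℚ}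
    (hC : C ∈ hodgeGroupLieRat (prodPeriod Φ₁ Φ₂)) : C = Matrix.fromBlocks C.toBlocks₁₁ 0 0 C.toBlocks₂₂ := by
  conv_lhs => rw [← Matrix.fromBlocks_toBlocks C, toBlocks₁₂_eq_zero_of_mem_hodgeGroupLieRat_prod Φ₁ Φ₂ hC,
    toBlocks₂₁_eq_zero_of_mem_hodgeGroupLieRat_prod Φ₁ Φ₂ hC]

/-- **GGK III.B (i) OVER `ℚ`: `𝒜(X₁ × X₂) ⊆ 𝒜(X₁) ⊕ 𝒜(X₂)`** (block-diagonally embedded), for every pair of complex tori —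
every `C ∈ 𝒜(X₁ × X₂)` is `(A 0; 0 B)` with `A ∈ 𝒜(X₁)`, `B ∈ 𝒜(X₂)` (the inclusion is strict in general).
[cite: GreenGriffithsKerr2012, §III.B (i) (p. 72: "`M_{φ₁+φ₂} ⊂ M_{φ₁} × M_{φ₂}` … in general not isomorphisms")] -/
theorem exists_eq_fromBlocks_of_mem_hodgeGroupLieRat_prod {C : Matrix (ι₁ ⊕ ι₂) (ι₁ ⊕ ι₂) ℚ}
    (hC : C ∈ hodgeGroupLieRat (prodPeriod Φ₁ Φ₂)) :
    ∃ A ∈ hodgeGroupLieRat Φ₁, ∃ B ∈ hodgeGroupLieRat Φ₂, C = Matrix.fromBlocks A 0 0 B :=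
  ⟨_, toBlocks₁₁_mem_hodgeGroupLieRat Φ₁ Φ₂ hC, _, toBlocks₂₂_mem_hodgeGroupLieRat Φ₁ Φ₂ hC,
    eq_fromBlocks_of_mem_hodgeGroupLieRat_prod Φ₁ Φ₂ hC⟩

/-- The same as an inclusion of sets of rational matrices. [cite: GreenGriffithsKerr2012, §III.B (i) (p. 72)] -/
theorem coe_hodgeGroupLieRat_prod_subset :
    (hodgeGroupLieRat (prodPeriod Φ₁ Φ₂) : Set (Matrix (ι₁ ⊕ ι₂) (ι₁ ⊕ ι₂) ℚ)) ⊆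
      (fun AB : Matrix ι₁ ι₁ ℚ × Matrix ι₂ ι₂ ℚ ↦ Matrix.fromBlocks AB.1 0 0 AB.2) ''
        ((hodgeGroupLieRat Φ₁ : Set (Matrix ι₁ ι₁ ℚ)) ×ˢ (hodgeGroupLieRat Φ₂ : Set (Matrix ι₂ ι₂ ℚ))) := by
  intro C hC
  obtain ⟨A, hA, B, hB, hCe⟩ := exists_eq_fromBlocks_of_mem_hodgeGroupLieRat_prod Φ₁ Φ₂ hC
  exact ⟨(A, B), Set.mk_mem_prod hA hB, hCe.symm⟩

/-- **`dim_ℚ 𝒜(X₁ × X₂) ≤ dim_ℚ 𝒜(X₁) + dim_ℚ 𝒜(X₂)`** for every pair of complex tori (`C ↦ (C₁₁, C₂₂)` is an injective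
`ℚ`-linear map into `𝒜(X₁) × 𝒜(X₂)`). [cite: GreenGriffithsKerr2012, §III.B (i) (p. 72)] -/
theorem finrank_hodgeGroupLieRat_prod_le :
    finrank ℚ (hodgeGroupLieRat (prodPeriod Φ₁ Φ₂)) ≤
      finrank ℚ (hodgeGroupLieRat Φ₁) + finrank ℚ (hodgeGroupLieRat Φ₂) := by
  let f : hodgeGroupLieRat (prodPeriod Φ₁ Φ₂) →ₗ[ℚ] hodgeGroupLieRat Φ₁ × hodgeGroupLieRat Φ₂ :=
    { toFun := fun C ↦ (⟨(C : Matrix (ι₁ ⊕ ι₂) (ι₁ ⊕ ι₂) ℚ).toBlocks₁₁, toBlocks₁₁_mem_hodgeGroupLieRat Φ₁ Φ₂ C.2⟩,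
        ⟨(C : Matrix (ι₁ ⊕ ι₂) (ι₁ ⊕ ι₂) ℚ).toBlocks₂₂, toBlocks₂₂_mem_hodgeGroupLieRat Φ₁ Φ₂ C.2⟩)
      map_add' := fun C D ↦ rfl
      map_smul' := fun c C ↦ rfl }
  have hf : Function.Injective f := by
    intro C D h
    apply Subtype.ext
    have h1 : (C : Matrix (ι₁ ⊕ ι₂) (ι₁ ⊕ ι₂) ℚ).toBlocks₁₁ = (D : Matrix (ι₁ ⊕ ι₂) (ι₁ ⊕ ι₂) ℚ).toBlocks₁₁ :=
      congrArg (fun x ↦ (x.1 : Matrix ι₁ ι₁ ℚ)) h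
    have h2 : (C : Matrix (ι₁ ⊕ ι₂) (ι₁ ⊕ ι₂) ℚ).toBlocks₂₂ = (D : Matrix (ι₁ ⊕ ι₂) (ι₁ ⊕ ι₂) ℚ).toBlocks₂₂ :=
      congrArg (fun x ↦ (x.2 : Matrix ι₂ ι₂ ℚ)) h
    rw [eq_fromBlocks_of_mem_hodgeGroupLieRat_prod Φ₁ Φ₂ C.2, eq_fromBlocks_of_mem_hodgeGroupLieRat_prod Φ₁ Φ₂ D.2, h1, h2]
  have h := LinearMap.finrank_le_finrank_of_injective hf
  rwa [Module.finrank_prod] at h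

end Prod

end ComplexTorus

end Literature.Geometry.Kaehler
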